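import Summits.KontsevichZagierPeriods.KontsevichZagierPeriods.Theses.WeightLine

/-!
# Birth skeleton of crux `WeightLine.UpperTruncationConstancy` (stmt-KontsevichZagierPeriods-17729)

Piece X1 of the BC2-redirect split of `BackwardVolterraRigidity` (crux-strategist r1, 2026-08-17):
RIGIDITY + TAMENESS, no limits. Two stubs, the proved arrow-form composition `UpperTruncationConstancy_of_subs`
and the skeleton theorem `UpperTruncationConstancy_of` (the route decl by name, fed by the stubs by name):
* `stub_sliceVanishing` (hardest; "no semialgebraic Volterra eigenfamily"): under `H(c)` the slice
  combination `G(t) = Σ k_j [slice_t R_j]` is a relation at every rational level `t > 0`;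
* `stub_levelTameness` (unconditional; Fubini + Comte–Lion–Rolin 2000 / Cluckers–Miller 2011 Thm 1.3):
  all but finitely many rational slices of an integral representation are integral representations.
Composition: exceptional set = union over `j` of the bad levels; at a good level choose slice
presentations, apply `H(c)` and subtract `G(t)`. Stub probes (stub → summit / → BVR / → this piece):
exact?, simpa, unfold+simpa, aesop all fail (folder bc/SliceVanishing_stubprobe, bc/LevelTameness_stubprobe).
-/

noncomputable section

open MeasureTheory Set
open Literature.NumberTheory.Transcendental Literature.NumberTheory.Transcendental.KZ

namespace Summit.KontsevichZagierPeriods.KontsevichZagierPeriods.Cruxes.UpperTruncationConstancy.Birth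

/-- **S1 · slice vanishing (the rigidity core, hardest).** Under `H(c)`, the slice combination
`G(t) = Σ k_j [slice_t R_j]` is a relation at every rational level `t > 0` (for all slice
presentations; vacuous at the finitely many levels where a slice is not presentable). "No
semialgebraic Volterra eigenfamily": the values obey `v + ∫_(>t) v = C`, forcing `v = Ae^t`, and
decay forces `A = C = 0`; implied by the kernel form of Conjecture 1. Cheapest rung: `d_j = 0`. -/
theorem stub_sliceVanishing :
    ∀ (J : ℕ) (d : Fin J → ℕ) (k : Fin J → ℤ) (R : (j : Fin J) → Literature.NumberTheory.Transcendental.KZ.IntegralRep (d j + 1)) (c : Literature.NumberTheory.Transcendental.KZ.FormalRep), (∀ t : ℚ, 0 < (t : ℝ) → ∀ (S : (j : Fin J) → Literature.NumberTheory.Transcendental.KZ.IntegralRep (d j)) (T : (j : Fin J) → Literature.NumberTheory.Transcendental.KZ.IntegralRep (d j + 1)), (∀ j, (S j).domain = {x | Fin.snoc x (t : ℝ) ∈ (R j).domain} ∧ Set.EqOn (S j).integrand (fun x => (R j).integrand (Fin.snoc x (t : ℝ))) (S j).domain ∧ (T j).domain = (R j).domain ∩ {z | (t : ℝ) < z (Fin.last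 (d j))} ∧ Set.EqOn (T j).integrand (R j).integrand (T j).domain) → ∑ j, k j • (Literature.NumberTheory.Transcendental.KZ.of (S j) + Literature.NumberTheory.Transcendental.KZ.of (T j)) - c ∈ Literature.NumberTheory.Transcendental.KZ.relations) → ∀ t : ℚ, 0 < (t : ℝ) → ∀ (S : (j : Fin J) → Literature.NumberTheory.Transcendental.KZ.IntegralRep (d j)), (∀ j, (S j).domain = {x | Fin.snoc x (t : ℝ) ∈ (R j).domain} ∧ Set.EqOn (S j).integrand (fun x => (R j).integrand (Fin.snoc x (t : ℝ))) (S j).domain) → ∑ j, k j • Literature.NumberTheory.Transcendental.KZ.of (S j) ∈ Literature.NumberTheory.Transcendental.KZ.relations := by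
  sorry

/-- **S2 · level tameness (unconditional).** All but finitely many rational slices of an integral
representation are integral representations (slice domain and integrand are `ℚ`-semialgebraic at a
rational level; integrability off a finite set of levels: Fubini gives a.e., tameness of parametric
integrals of semialgebraic families — Comte–Lion–Rolin 2000, Cluckers–Miller 2011 Thm 1.3 — makes the
bad set finite). Trivial for `d = 0`. -/
theorem stub_levelTameness :
    ∀ (d : ℕ) (R : Literature.NumberTheory.Transcendental.KZ.IntegralRep (d + 1)), ∃ F : Finset ℚ, ∀ t : ℚ, t ∉ F → ∃ S : Literature.NumberTheory.Transcendental.KZ.IntegralRep d, S.domain = {x | Fin.snoc x (t : ℝ) ∈ R.domain} ∧ Set.EqOn S.integrand (fun x => R.integrand (Fin.snoc x (t : ℝ))) S.domain := by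
  sorry


/-- **Piece 1 from its two stubs.** `UpperTruncationConstancy` from `stub_sliceVanishing` (S1) and
`stub_levelTameness` (S2): the exceptional set is the union over `j` of the finitely many
non-presentable rational levels of `R_j`; at any other level `t > 0` choose slice presentations `S_j`
(S2), apply `H(c)` to `(S, T)` and subtract `G(t) ∈ relations` (S1). [cite: KontsevichZagier2001, §1.2] -/
theorem UpperTruncationConstancy_of_subs
    (h₁ : ∀ (J : ℕ) (d : Fin J → ℕ) (k : Fin J → ℤ) (R : (j : Fin J) → Literature.NumberTheory.Transcendental.KZ.IntegralRep (d j + 1)) (c : Literature.NumberTheory.Transcendental.KZ.FormalRep), (∀ t : ℚ, 0 < (t : ℝ) → ∀ (S : (j : Fin J) → Literature.NumberTheory.Transcendental.KZ.IntegralRep (d j)) (T : (j : Fin J) → Literature.NumberTheory.Transcendental.KZ.IntegralRep (d j + 1)), (∀ j, (S j).domain = {x | Fin.snoc x (t : ℝ) ∈ (R j).domain} ∧ Set.EqOn (S j).integrand (fun x => (R j).integrand (Fin.snoc x (t : ℝ))) (S j).domain ∧ (T j).domain = (R j).domain ∩ {z | (t : ℝ) < z (Fin.last (d j))} ∧ Set.EqOn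 (T j).integrand (R j).integrand (T j).domain) → ∑ j, k j • (Literature.NumberTheory.Transcendental.KZ.of (S j) + Literature.NumberTheory.Transcendental.KZ.of (T j)) - c ∈ Literature.NumberTheory.Transcendental.KZ.relations) → ∀ t : ℚ, 0 < (t : ℝ) → ∀ (S : (j : Fin J) → Literature.NumberTheory.Transcendental.KZ.IntegralRep (d j)), (∀ j, (S j).domain = {x | Fin.snoc x (t : ℝ) ∈ (R j).domain} ∧ Set.EqOn (S j).integrand (fun x => (R j).integrand (Fin.snoc x (t : ℝ))) (S j).domain) → ∑ j, k j • Literature.NumberTheory.Transcendental.KZ.of (S j) ∈ Literature.NumberTheory.Transcendental.KZ.relations)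
    (h₂ : ∀ (d : ℕ) (R : Literature.NumberTheory.Transcendental.KZ.IntegralRep (d + 1)), ∃ F : Finset ℚ, ∀ t : ℚ, t ∉ F → ∃ S : Literature.NumberTheory.Transcendental.KZ.IntegralRep d, S.domain = {x | Fin.snoc x (t : ℝ) ∈ R.domain} ∧ Set.EqOn S.integrand (fun x => R.integrand (Fin.snoc x (t : ℝ))) S.domain) :
    ∀ (J : ℕ) (d : Fin J → ℕ) (k : Fin J → ℤ) (R : (j : Fin J) → Literature.NumberTheory.Transcendental.KZ.IntegralRep (d j + 1)) (c : Literature.NumberTheory.Transcendental.KZ.FormalRep), (∀ t : ℚ, 0 < (t : ℝ) → ∀ (S : (j : Fin J) → Literature.NumberTheory.Transcendental.KZ.IntegralRep (d j)) (T : (j : Fin J) → Literature.NumberTheory.Transcendental.KZ.IntegralRep (d j + 1)), (∀ j, (S j).domain = {x | Fin.snoc x (t : ℝ) ∈ (R j).domain} ∧ Set.EqOn (S j).integrand (fun x => (R j).integrand (Fin.snoc x (t : ℝ))) (S j).domain ∧ (T j).domain = (R j).domain ∩ {z | (t : ℝ) < z (Fin.last (d j))} ∧ Set.EqOn (T j).integrand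 (R j).integrand (T j).domain) → ∑ j, k j • (Literature.NumberTheory.Transcendental.KZ.of (S j) + Literature.NumberTheory.Transcendental.KZ.of (T j)) - c ∈ Literature.NumberTheory.Transcendental.KZ.relations) → ∃ F : Finset ℚ, ∀ t : ℚ, 0 < (t : ℝ) → t ∉ F → ∀ (T : (j : Fin J) → Literature.NumberTheory.Transcendental.KZ.IntegralRep (d j + 1)), (∀ j, (T j).domain = (R j).domain ∩ {z | (t : ℝ) < z (Fin.last (d j))} ∧ Set.EqOn (T j).integrand (R j).integrand (T j).domain) → ∑ j, k j • Literature.NumberTheory.Transcendental.KZ.of (T j) - c ∈ Literature.NumberTheory.Transcendental.KZ.relations := by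
  intro J d k R c hH
  classical
  choose F hF using fun j => h₂ (d j) (R j)
  refine ⟨Finset.univ.biUnion F, ?_⟩
  intro t ht htF T hT
  have htj : ∀ j, t ∉ F j := fun j hj =>
    htF (Finset.mem_biUnion.mpr ⟨j, Finset.mem_univ j, hj⟩)
  choose S hSd hSi using fun j => hF j t (htj j)
  have hG : ∑ j, k j • of (S j) ∈ relations :=
    h₁ J d k R c hH t ht S fun j => ⟨hSd j, hSi j⟩
  have hGT : ∑ j, k j • (of (S j) + of (T j)) - c ∈ relations :=
    hH t ht S T fun j => ⟨hSd j, hSi j, (hT j).1, (hT j).2⟩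
  have key : ∑ j, k j • of (T j) - c =
      (∑ j, k j • (of (S j) + of (T j)) - c) - ∑ j, k j • of (S j) := by
    simp only [smul_add, Finset.sum_add_distrib]
    abel
  rw [key]
  exact relations.sub_mem hGT hG

/-- **Skeleton theorem** (concludes the crux BY NAME): `WeightLine.UpperTruncationConstancy` from the two
declared stubs, through the sorry-free arrow-form composition `UpperTruncationConstancy_of_subs`. -/
theorem UpperTruncationConstancy_of : Summit.KontsevichZagierPeriods.KontsevichZagierPeriods.Theses.WeightLine.UpperTruncationConstancy :=
  UpperTruncationConstancy_of_subs stub_sliceVanishing stub_levelTameness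

end Summit.KontsevichZagierPeriods.KontsevichZagierPeriods.Cruxes.UpperTruncationConstancy.Birth

end
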